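import Literature.Analysis.FluidPDE.HeatFlowLocalEnstrophy
import HarnessLib

/-!
# The global `L²` energy inequality of the free heat flow (topic `Analysis/PDE`)

Analytic layer of the programme to prove short-time existence for quasilinear strictly
parabolic systems on a closed manifold (hypothesis `hQL` of
`Literature.Geometry.Riemannian.ricciFlow_shortTime_existence_of_quasilinear`). The zero
initial-value solution of the inhomogeneous heat equation on `[0, T]` is the forward Duhamel
integral (`HeatForwardDuhamel.lean`) corrected by the FREE flow `e^{νtΔ}h` of its value `h` at
time `0`; the Hessian of the correction is controlled by the global `L²` energy inequality of
the free flow, Lemarié-Rieusset 2016, Prop. 4.3 (A) (`‖e^{tΔ}g‖₂² + 2∫₀ᵗ‖∇e^{sΔ}g‖₂² = ‖g‖₂²`),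
proved here in the inequality form

* `lintegral_prod_frobeniusNormSq_fderiv_heatExtension_le` —
  `∫∫_{(0,t) × E} |∇ e^{τΔ} g|² dx dτ ≤ ‖g‖₂²` for `g ∈ L²(E; F')` (`E`, `F'` finite-dimensional
  real inner product spaces),

from the tree's local energy inequality with cut-offs
(`setLIntegral_box_frobeniusNormSq_fderiv_heatExtension_le`, `HeatFlowLocalEnstrophy.lean`:
`∫∫_{(s,t) × B_R} |∇u|² ≤ Eb (1 + 4 n M² t)` with `Eb` a bound for the local energy and
`M = C/R` a bound for the cut-off gradient) by letting `R → ∞` (monotone convergence of the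
boxes; the energy majorant is the global `‖g‖₂²` by the `L²` contraction
`eLpNorm_heatExtension_le_holds`, and `4 n C² ‖g‖₂² t / R² → 0`) and then `s → 0⁺`.
(The sharp constant `1/2` is not needed downstream.)

Everything is proved; no named fact and no `sorry` is introduced.

## References

* P. G. Lemarié-Rieusset, *The Navier–Stokes problem in the 21st century*, CRC Press 2016,
  Prop. 4.3 (A), p. 74; Thm. 14.1, proof, Step 1. [LemarieRieusset2016]
* L. C. Evans, *Partial Differential Equations*, 2nd ed., AMS 2010, §2.3.1 and §7.1.2 (energy
  estimates). [Evans2010]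
-/

noncomputable section

open MeasureTheory Set Function Filter Topology TopologicalSpace Metric InnerProductSpace
open scoped NNReal ENNReal RealInnerProductSpace Laplacian

namespace Literature.Analysis.PDE

open Literature.Analysis.UnboundedOperators Literature.Analysis.FluidPDE

variable {E : Type*} [NormedAddCommGroup E] [InnerProductSpace ℝ E] [FiniteDimensional ℝ E]
  [MeasurableSpace E] [BorelSpace E]
variable {F' : Type*} [NormedAddCommGroup F'] [InnerProductSpace ℝ F'] [FiniteDimensional ℝ F']
variable {g : E → F'}

/-- **Enstrophy of the free heat flow on `(s, t) × E`, `0 < s`**: for `g ∈ L²`,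
`∫∫_{(s,t) × E} |∇e^{τΔ}g|² ≤ ‖g‖₂²` (the local energy inequality with cut-offs of radius
`R → ∞`). [cite: LemarieRieusset2016, Prop. 4.3 (A)] -/
theorem lintegral_Ioo_prod_frobeniusNormSq_fderiv_heatExtension_le (hg : MemLp g 2 volume)
    {s t : ℝ} (hs : 0 < s) (hst : s ≤ t) :
    ∫⁻ z in Ioo s t ×ˢ (univ : Set E),
        ENNReal.ofReal (frobeniusNormSq (fderiv ℝ (heatExtension g z.1) z.2)) ≤
      eLpNorm g 2 volume ^ 2 := by
  haveI : CompleteSpace F' := FiniteDimensional.complete ℝ F'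
  have h2 : (2 : ℝ≥0∞) ≠ ∞ := ENNReal.ofNat_ne_top
  obtain ⟨C₀, hC₀, hC⟩ := exists_norm_fderiv_cutoff_le (E := E)
  set n : ℝ := (Module.finrank ℝ E : ℝ) with hn
  -- the global energy majorant
  set Eb : ℝ := (eLpNorm g 2 volume ^ 2).toReal with hEbdef
  have hEb : 0 ≤ Eb := ENNReal.toReal_nonneg
  have hEtop : eLpNorm g 2 volume ^ 2 ≠ ∞ := ENNReal.pow_ne_top hg.eLpNorm_ne_top
  have hE : ∀ (x₀ : E) (R : ℝ), ∀ τ : ℝ, 0 < τ →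
      ∫ x in ball x₀ (3 * R), ‖heatExtension g τ x‖ ^ 2 ≤ Eb := fun x₀ R τ hτ ↦ by
    have h := integral_ball_norm_heatExtension_sq_le le_rfl h2 hg hτ x₀ (3 * R)
    have h1 : volume (ball (0 : E) (3 * R)) ^ (1 - 2 / (2 : ℝ≥0∞).toReal) = 1 := by
      rw [ENNReal.toReal_ofNat, div_self two_ne_zero, sub_self, ENNReal.rpow_zero]
    rw [h1, one_mul] at h
    exact h
  -- the boxes `(s,t) × B_R(0)` exhaust `(s,t) × E`
  have hbox : ∀ R : ℝ, 0 < R → ∫⁻ z in Ioo s t ×ˢ ball (0 : E) R,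
      ENNReal.ofReal (frobeniusNormSq (fderiv ℝ (heatExtension g z.1) z.2)) ≤
        ENNReal.ofReal (Eb + 4 * n * (C₀ / R) ^ 2 * Eb * t) := fun R hR ↦
    setLIntegral_box_frobeniusNormSq_fderiv_heatExtension_le hg one_le_two hR 0 (hC R hR) hEb
      (hE 0 R) hs hst
  -- monotone convergence in `R = k + 1`
  have hmono : Monotone fun k : ℕ ↦ Ioo s t ×ˢ ball (0 : E) ((k : ℝ) + 1) := by
    intro k l hkl
    refine prod_mono le_rfl (ball_subset_ball ?_)
    have : (k : ℝ) ≤ l := Nat.cast_le.2 hkl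
    linarith
  have hunion : (⋃ k : ℕ, Ioo s t ×ˢ ball (0 : E) ((k : ℝ) + 1)) = Ioo s t ×ˢ (univ : Set E) := by
    rw [← prod_iUnion]
    congr 1
    refine eq_univ_of_forall fun x ↦ mem_iUnion.2 ?_
    obtain ⟨k, hk⟩ := exists_nat_gt ‖x‖
    exact ⟨k, mem_ball_zero_iff.2 (by linarith)⟩
  rw [← hunion, setLIntegral_iUnion_of_directed (fun z : ℝ × E ↦
    ENNReal.ofReal (frobeniusNormSq (fderiv ℝ (heatExtension g z.1) z.2))) hmono.directed_le]
  refine iSup_le fun k ↦ ?_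
  refine le_of_forall_pos_le_add fun ε hε ↦ ?_
  -- choose `k' ≥ k` so large that the error term is `≤ ε`; monotonicity in the box
  have htend : Tendsto (fun m : ℕ ↦ ENNReal.ofReal (Eb + 4 * n * (C₀ / ((m : ℝ) + 1)) ^ 2 * Eb * t))
      atTop (𝓝 (ENNReal.ofReal Eb)) := by
    refine ENNReal.tendsto_ofReal ?_
    have h1 : Tendsto (fun m : ℕ ↦ C₀ / ((m : ℝ) + 1)) atTop (𝓝 0) :=
      tendsto_const_nhds.div_atTop (tendsto_natCast_atTop_atTop.atTop_add tendsto_const_nhds)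
    have h2 : Tendsto (fun m : ℕ ↦ Eb + 4 * n * (C₀ / ((m : ℝ) + 1)) ^ 2 * Eb * t) atTop
        (𝓝 (Eb + 4 * n * 0 ^ 2 * Eb * t)) :=
      tendsto_const_nhds.add (((tendsto_const_nhds.mul (h1.pow 2)).mul tendsto_const_nhds).mul
        tendsto_const_nhds)
    simpa using h2
  have hEb' : ENNReal.ofReal Eb = eLpNorm g 2 volume ^ 2 := by
    rw [hEbdef, ENNReal.ofReal_toReal hEtop]
  have hev : ∀ᶠ m : ℕ in atTop, ENNReal.ofReal (Eb + 4 * n * (C₀ / ((m : ℝ) + 1)) ^ 2 * Eb * t) ≤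
      eLpNorm g 2 volume ^ 2 + ε := by
    have hlt : ENNReal.ofReal Eb < eLpNorm g 2 volume ^ 2 + ε := by
      rw [hEb']
      exact ENNReal.lt_add_right hEtop hε.ne'
    exact (htend.eventually (gt_mem_nhds hlt)).mono fun m hm ↦ hm.le
  obtain ⟨m, hm, hmk⟩ := (hev.and (eventually_ge_atTop k)).exists
  calc ∫⁻ z in Ioo s t ×ˢ ball (0 : E) ((k : ℝ) + 1),
        ENNReal.ofReal (frobeniusNormSq (fderiv ℝ (heatExtension g z.1) z.2))
      ≤ ∫⁻ z in Ioo s t ×ˢ ball (0 : E) ((m : ℝ) + 1),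
          ENNReal.ofReal (frobeniusNormSq (fderiv ℝ (heatExtension g z.1) z.2)) :=
        lintegral_mono_set (hmono hmk)
    _ ≤ ENNReal.ofReal (Eb + 4 * n * (C₀ / ((m : ℝ) + 1)) ^ 2 * Eb * t) :=
        hbox _ (by positivity)
    _ ≤ eLpNorm g 2 volume ^ 2 + ε := hm

/-- **The global `L²` energy inequality of the free heat flow** (Lemarié-Rieusset 2016,
Prop. 4.3 (A), in inequality form): for `g ∈ L²(E; F')` and `0 ≤ t`,
`∫∫_{(0,t) × E} |∇ e^{τΔ} g|² dx dτ ≤ ‖g‖₂²` (`s → 0⁺` in the previous bound by monotone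
convergence). [cite: LemarieRieusset2016, Prop. 4.3 (A)] -/
theorem lintegral_prod_frobeniusNormSq_fderiv_heatExtension_le (hg : MemLp g 2 volume) (t : ℝ) :
    ∫⁻ z in Ioo 0 t ×ˢ (univ : Set E),
        ENNReal.ofReal (frobeniusNormSq (fderiv ℝ (heatExtension g z.1) z.2)) ≤
      eLpNorm g 2 volume ^ 2 := by
  rcases le_or_gt t 0 with ht | ht
  · rw [Ioo_eq_empty (not_lt.2 ht), empty_prod, Measure.restrict_empty, lintegral_zero_measure]
    exact bot_le
  -- `(0,t) × E = ⋃ₖ (t/(k+2), t) × E`, increasing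
  have hmono : Monotone fun k : ℕ ↦ Ioo (t / ((k : ℝ) + 2)) t ×ˢ (univ : Set E) := by
    intro k l hkl
    refine prod_mono (Ioo_subset_Ioo ?_ le_rfl) le_rfl
    refine div_le_div_of_nonneg_left ht.le (by positivity) ?_
    have : (k : ℝ) ≤ l := Nat.cast_le.2 hkl
    linarith
  have hunion : (⋃ k : ℕ, Ioo (t / ((k : ℝ) + 2)) t ×ˢ (univ : Set E)) = Ioo 0 t ×ˢ univ := by
    rw [← iUnion_prod_const]
    congr 1
    ext τ
    simp only [mem_iUnion, mem_Ioo]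
    constructor
    · rintro ⟨k, hk1, hk2⟩
      exact ⟨(div_pos ht (by positivity)).trans hk1, hk2⟩
    · rintro ⟨h0, h1⟩
      obtain ⟨k, hk⟩ := exists_nat_gt (t / τ)
      refine ⟨k, ?_, h1⟩
      rw [div_lt_iff₀ (by positivity)]
      rw [div_lt_iff₀ h0] at hk
      nlinarith
  rw [← hunion, setLIntegral_iUnion_of_directed (fun z : ℝ × E ↦
    ENNReal.ofReal (frobeniusNormSq (fderiv ℝ (heatExtension g z.1) z.2))) hmono.directed_le]
  refine iSup_le fun k ↦ ?_
  refine lintegral_Ioo_prod_frobeniusNormSq_fderiv_heatExtension_le hg (div_pos ht (by positivity)) ?_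
  exact div_le_self ht.le (by linarith [(Nat.cast_nonneg k : (0 : ℝ) ≤ k)] : (1 : ℝ) ≤ (k : ℝ) + 2)

end Literature.Analysis.PDE

end
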